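import Literature.MathematicalPhysics.QuantumFieldTheory.King1986.MinimizerTwoSpacing
import Literature.MathematicalPhysics.QuantumFieldTheory.King1986.MinimizerTowerBridge
import HarnessLib

/-!
# King 1986, PROPOSITION 3.8 (3.71), FIRST LINE, IN ITS PRINTED SHAPE `≦ CL^{−γk}exp[−δ₀|x − z|]`, UNCONDITIONALLY, for
# the ACTUAL block-spin minimiser kernels on Bałaban's tori — the sup rate `king_prop38_torus` «combined with Theorem 3.3»

**Citation header (reproduction of PUBLISHED and PROVED work; seat `pub-ymgap-dag-n18-b` of the cell `pub-ymgap`,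
Track-A node N18 = NE5 whose PRINTED MODEL of record is King's Prop. 3.8; the LAST file of the seat's chain
`MinimizerAliasModes` → `MinimizerFourier` → `MinimizerAliasRate` → `TorusAliasDigits` → `MinimizerTwoSpacing` →
`MinimizerTowerBridge` → THIS FILE, which composes `king_prop38_torus_of_decay` (p410885) with the transported
Theorem 3.3 decay `minimiser_kernel_decay` (`MinimizerTowerBridge`, from lit-balaban's `B4Thm110ZeroTorus.thm110_zero_torus`).)**
C. King, *The U(1) Higgs model. I. The continuum limit*, Commun. Math. Phys. **102** (1986) 649–677 [King1986], §3.4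
Proposition 3.8 (3.71) p. 664; p. 674 «Therefore every term in (4.19) for m = 0 can be replaced, and so combining our
bounds with Theorem 3.3 we deduce (3.71).»; Theorem 3.3 p. 658 (uniform exponential decay, «see [Ba 4]»).  Page images
read by this seat: `b2b-balaban-template/king-renders/1986-cmp102-king-u1-higgs-I-p016-x2.png`, `…-p026-x2.png`.
[Ba 4] = T. Bałaban, *Regularity and decay of lattice Green's functions*, CMP **89** (1983) [Balaban1983RegularityDecay],
Theorem (1.10) p. 573.  King's paper is TEMPLATE LITERATURE (`A = 0` mechanism); nothing here is about Bałaban's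
covariant objects.

**What this file PROVES (kernel; one `def`: `(⟨P.d, P.L, P.m, P.K + n, P.hd, P.hL⟩ : Params) = (d, L, m, K + n)`).**
* §1 the constants agree: `aSeq_eq_aK` (`B1.aSeq = EffectiveLaplacianRate.aK`, both `a(1 − L⁻²)/(1 − L^{−2k})`),
  `eps_inv_sq` (`ε⁻² = (L^K)²`).
* §2 `minimiser_kernel_decay_labels`: the bridge's Theorem-3.3 decay restated with King's `aK`, `c = (L^K)²`, for any
  spelling `N = L^K` of the fine torus and for King-side points given by their LABELS (so that both runs of (3.71) can
  be fed: `N = L^K` and `N = L^n·L^K`).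
* §3 **`king_prop38_torus_printed`**: for `d ≥ 1`, odd `L ≥ 2`, `a > 0`, `m² > 0`, `0 ≤ γ ≤ 1` there are `δ₀, c₀ > 0`
  (functions of `d, L, a, m²` only) such that for EVERY volume `(d, L, m, K)`, `K ≥ 1`, every `n ≥ 1`, the unit torus
  `M_μ = 2L^m`, every unit site `b`, fine points `x′` over `x` and `0 ≤ t ≤` the physical sup-distances from `x`, `x′` to
  the block of `b`:
  `|ℋ_{K+n}(x′, b) − ℋ_K(x, b)| ≤ √(2ac₀(C₁ + C₂)L^{−γK})·e^{−δ₀t/2}` — (3.71) line 1 with `C = √(2ac₀(C₁+C₂))`,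
  `γ′ = γ/2`, `δ₀′ = δ₀/2`, for the ACTUAL operators `ℋ_K = minimiser (L^K) M a_K (L^{2K}) m² δ_b`,
  `ℋ_{K+n} = minimiser (L^nL^K) M a_{K+n} ((L^nL^K)²) m² δ_b` of `EffectiveLaplacianSymbol`; no hypothesis beyond the
  printed setting (the distances are measured on the lit-balaban tower's tori through the points with the same labels,
  `B5Ineq137Torus.T`).

**NOT COVERED.**  The Hölder and derivative lines of (3.71); unit tori other than `2L^m` (the sup rate holds for all,
the decay is certified for these); even `L`; free boundary conditions; Prop. 3.9 (3.73) (whose remaining input on the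
torus is now only the assembly `SingleScaleRate.prod3_rate` with `CovarianceRateTorus.king_lemma45_torus`); `A ≠ 0`.
HONEST FRAMING: King's `A = 0` scalar MODEL of the NE5 «η-rate» mechanism — template literature, finite torus; nothing
about Bałaban's covariant block averaging; nothing continuum ∕ mass-gap ∕ Clay; count-neutral for the cell's 27 nodes.
-/

noncomputable section

open Finset Real Matrix
open scoped BigOperators

namespace Literature.MathematicalPhysics.QuantumFieldTheory.King1986

open Literature.MathematicalPhysics.QuantumFieldTheory.Balaban1983to89 (Params)
open Literature.MathematicalPhysics.QuantumFieldTheory.Balaban1983to89.B5Prop11Plancherel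

namespace Torus

variable {d : ℕ}

/-! ## §1 The two constants conventions agree: `B1.aSeq = aK`, `ε⁻² = L^{2K}` -/

/-- King's `a_k = a(1 − L⁻²)(1 − L^{−2k})⁻¹` ((2.13) p.653) IS Bałaban's `a_k` of B1 (2.13)/(2.15) (the tree's two
spellings `EffectiveLaplacianRate.aK` and `B1.aSeq` coincide). [cite: King1986, (2.13) p.653; Balaban1982Higgs1, (2.15) p.609] -/
theorem aSeq_eq_aK (a L : ℝ) (k : ℕ) : Balaban1983to89.B1.aSeq a L k = aK a L k := by
  rw [Balaban1983to89.B1.aSeq_eq, aK]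
  simp only [inv_pow, ← pow_mul]

/-- `ε⁻² = (L^K)²` for the volume `P` (`ε = L^{−K}`). [cite: Balaban1987RG1, (0.1) p.251] -/
theorem eps_inv_sq (P : Params) : (P.eps⁻¹) ^ 2 = (((P.L ^ P.K : ℕ) : ℝ)) ^ 2 := by
  rw [Params.eps]
  push_cast
  simp [inv_pow]

/-! ## §2 King's Theorem 3.3 for `ℋ_K` in King's own typing (labels instead of the dictionary maps) -/

/-- `minimiser_kernel_decay` restated for King-side points given by their LABELS: for any `N = L^K` (so that the type
`Tor (fine N M)` may be spelled as the consumer needs it, e.g. `N = L^n·L^k`), any `x̃`, `b̃` whose labels are those of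
tower points `x`, `b`, the decay `|ℋ_K(x̃, b̃)| ≤ a_K·c₀·e^{−δ₀εD}` holds with King's `a_K = aK a L K` and `c = (L^K)²`.
[cite: King1986, Theorem 3.3 p.658; Balaban1983RegularityDecay, Theorem (1.10) p.573] -/
theorem minimiser_kernel_decay_labels (dd L : ℕ) (hd : 1 ≤ dd) (hL : Odd L ∧ 1 < L) {a : ℝ} (ha : 0 < a)
    {msq : ℝ} (hmsq : 0 ≤ msq) :
    ∃ δ₀ c₀ : ℝ, 0 < δ₀ ∧ 0 < c₀ ∧ ∀ (P : Params), P.d = dd → P.L = L → 1 ≤ P.K →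
      ∀ (M : Fin P.d → ℕ) [∀ μ, NeZero (M μ)] (_hMK : ∀ μ, M μ = P.sitesPerDir P.K)
        (N : ℕ) [NeZero N] (_hN : N = P.L ^ P.K)
        (xt : Tor (fine N M)) (x : Balaban1983to89.Site P 0) (_hx : ∀ μ, (xt μ).val = (x μ).val)
        (bt : Tor M) (b : Balaban1983to89.Site P P.K) (_hb : ∀ μ, (bt μ).val = (b μ).val)
        (D : ℝ), 0 ≤ D →
        (∀ z : Balaban1983to89.Site P 0, Balaban1983to89.Site.proj P.K P.K z = b →
          D ≤ Balaban1983to89.B5Ineq137Torus.T P 0 x z) →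
        |minimiser N M (aK a P.L P.K) (((N : ℕ) : ℝ) ^ 2) msq (Pi.single bt 1) xt|
          ≤ aK a P.L P.K * c₀ * Real.exp (-(δ₀ * (P.eps * D))) := by
  obtain ⟨δ₀, c₀, hδ₀, hc₀, H⟩ := minimiser_kernel_decay dd L hd hL ha hmsq
  refine ⟨δ₀, c₀, hδ₀, hc₀, ?_⟩
  intro P hPd hPL hK M _ hMK N _ hN xt x hx bt b hb D hD0 hD
  subst hN
  have hxt : xt = toTor P M hMK x := by
    funext μ; apply ZMod.val_injective; rw [hx, val_toTor]
  have hbt : bt = toTorUnit P M hMK b := by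
    funext μ; apply ZMod.val_injective; rw [hb, val_toTorUnit]
  subst hxt hbt
  rw [← aSeq_eq_aK, ← eps_inv_sq]
  exact H P hPd hPL hK M hMK x b D hD0 hD

/-! ## §3 (3.71), first line, AS PRINTED, for Bałaban's volumes: `|ℋ_{k+n}(x′,b) − ℋ_k(x,b)| ≤ CL^{−γ′k}e^{−δ₀′|x−b|}` -/

/-- The volume with `n` more renormalization steps over the same unit torus, `(d, L, m, K + n)`, has the same unit
torus `2L^m`. [cite: Balaban1987RG1, (0.1) p.251] -/
theorem sitesPerDir_finerVolume (P : Params) (n : ℕ) :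
    (⟨P.d, P.L, P.m, P.K + n, P.hd, P.hL⟩ : Params).sitesPerDir (P.K + n) = P.sitesPerDir P.K := by
  simp only [Params.sitesPerDir, Nat.add_sub_cancel]

/-- **KING'S (3.71), FIRST LINE, IN ITS PRINTED SHAPE, FOR BAŁABAN'S VOLUMES — UNCONDITIONAL.**  For `d ≥ 1`, odd
`L ≥ 2` (i.e. `≥ 3`), `a > 0`, `m² > 0`, `0 ≤ γ ≤ 1` there are `δ₀, c₀ > 0` (functions of `d, L, a, m²` only) such that
for every volume `P = (d, L, m, K)` with `K ≥ 1`, every `n ≥ 1`, the unit torus `M_μ = 2L^m` of `P`, King's minimiser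
kernels `ℋ_K = a_KG^η_KQ^*_K` on `T_η = Tor (fine L^K M)` and `ℋ_{K+n}` on `T_{η′} = Tor (fine (L^nL^K) M)` (the ACTUAL
operators of `EffectiveLaplacianSymbol`, `a_K = aK a L K`, `c = η⁻²`), every unit site `b` and fine points `x′` over `x`
(`x_μ = ⌊x′_μ/L^n⌋`), and every `t ≥ 0` not exceeding the physical sup-distance from `x` (resp. `x′`) to the block of `b`
(measured on the tower's tori through points with the same labels):
`|ℋ_{K+n}(x′, b) − ℋ_K(x, b)| ≤ √(2ac₀(C₁ + C₂)·L^{−γK})·e^{−δ₀t/2}` — King's `CL^{−γ′k}exp[−δ₀′|x − z|]`, `γ′ = γ/2`,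
`δ₀′ = δ₀/2`, with `C₁ = prop38RateConst a a θ (π²/4)^d d γ`, `C₂ = prop38PosConst a (π²/4)^d d γ`, `θ = lemma43Const`.
Inputs: the sup rate `king_prop38_torus` ((4.19)–(4.31)), the decay `minimiser_kernel_decay` (= Theorem 3.3 via
[Ba 4] (1.10), lit-balaban's `thm110_zero_torus`), the interpolation `king_prop38_torus_of_decay` («combining our bounds
with Theorem 3.3», p.674). [cite: King1986, Prop. 3.8 (3.71) p.664, p.674] -/
theorem king_prop38_torus_printed (dd L : ℕ) (hd : 1 ≤ dd) (hLodd : Odd L) (hL : 2 ≤ L) {a m2 : ℝ} (ha : 0 < a)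
    (hm : 0 < m2) {γ : ℝ} (hγ0 : 0 ≤ γ) (hγ1 : γ ≤ 1) :
    ∃ δ₀ c₀ : ℝ, 0 < δ₀ ∧ 0 < c₀ ∧ ∀ (P : Params) (_hPd : P.d = dd) (_hPL : P.L = L) (_hK : 1 ≤ P.K) [NeZero P.L]
      (n : ℕ) (_hn : 1 ≤ n) (M : Fin P.d → ℕ) [∀ μ, NeZero (M μ)] (_hMK : ∀ μ, M μ = P.sitesPerDir P.K)
      (xt : Tor (fine (P.L ^ P.K) M)) (xt' : Tor (fine (P.L ^ n * P.L ^ P.K) M)) (bt : Tor M)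
      (_hxx : ∀ μ, (xt μ).val = (xt' μ).val / P.L ^ n)
      (x : Balaban1983to89.Site P 0) (x' : Balaban1983to89.Site ((⟨P.d, P.L, P.m, P.K + n, P.hd, P.hL⟩ : Params)) 0)
      (b : Balaban1983to89.Site P P.K) (b' : Balaban1983to89.Site ((⟨P.d, P.L, P.m, P.K + n, P.hd, P.hL⟩ : Params)) (P.K + n))
      (_hx : ∀ μ, (xt μ).val = (x μ).val) (_hx' : ∀ μ, (xt' μ).val = (x' μ).val)
      (_hb : ∀ μ, (bt μ).val = (b μ).val) (_hb' : ∀ μ, (bt μ).val = (b' μ).val)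
      (t : ℝ), 0 ≤ t →
      (∀ z : Balaban1983to89.Site P 0, Balaban1983to89.Site.proj P.K P.K z = b →
        t ≤ P.eps * Balaban1983to89.B5Ineq137Torus.T P 0 x z) →
      (∀ z' : Balaban1983to89.Site ((⟨P.d, P.L, P.m, P.K + n, P.hd, P.hL⟩ : Params)) 0,
        Balaban1983to89.Site.proj (P.K + n) (P.K + n) z' = b' →
        t ≤ ((⟨P.d, P.L, P.m, P.K + n, P.hd, P.hL⟩ : Params)).eps * Balaban1983to89.B5Ineq137Torus.T ((⟨P.d, P.L, P.m, P.K + n, P.hd, P.hL⟩ : Params)) 0 x' z') →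
      |minimiser (P.L ^ n * P.L ^ P.K) M (aK a P.L (P.K + n)) (((P.L ^ n * P.L ^ P.K : ℕ) : ℝ) ^ 2) m2
            (Pi.single bt 1) xt'
          - minimiser (P.L ^ P.K) M (aK a P.L P.K) (((P.L ^ P.K : ℕ) : ℝ) ^ 2) m2 (Pi.single bt 1) xt|
        ≤ Real.sqrt (((prop38RateConst a a (lemma43Const a P.L P.K n) ((π ^ 2 / 4) ^ P.d) P.d γ
                + prop38PosConst a ((π ^ 2 / 4) ^ P.d) P.d γ) * ((P.L ^ P.K : ℕ) : ℝ) ^ (-γ)) * (2 * (a * c₀)))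
            * Real.exp (-(δ₀ / 2 * t)) := by
  have hL1 : 1 < L := by omega
  obtain ⟨δ₀, c₀, hδ₀, hc₀, H⟩ := minimiser_kernel_decay_labels dd L hd ⟨hLodd, hL1⟩ ha hm.le
  refine ⟨δ₀, c₀, hδ₀, hc₀, ?_⟩
  intro P hPd hPL hK _ n hn M _ hMK xt xt' bt hxx x x' b b' hx hx' hb hb' t ht0 hD hD'
  have hLr : (1 : ℝ) < P.L := by exact_mod_cast P.hL.2
  have hPd0 : 0 < P.d := by have := P.hd; omega
  have hPodd : Odd P.L := P.hL.1
  have hPL2 : 2 ≤ P.L := by have := P.hL.2; omega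
  -- run A: volume `P`
  have hεA : 0 < P.eps := Params.eps_pos P
  have hA := H P hPd hPL hK M hMK (P.L ^ P.K) rfl xt x hx bt b hb (t / P.eps) (div_nonneg ht0 hεA.le)
    (fun z hz => by rw [div_le_iff₀ hεA, mul_comm]; exact hD z hz)
  rw [mul_div_cancel₀ _ hεA.ne'] at hA
  have hdecA : |minimiser (P.L ^ P.K) M (aK a P.L P.K) (((P.L ^ P.K : ℕ) : ℝ) ^ 2) m2 (Pi.single bt 1) xt|
      ≤ a * c₀ * Real.exp (-(δ₀ * t)) :=
    hA.trans (mul_le_mul_of_nonneg_right (mul_le_mul_of_nonneg_right (aK_le ha hLr hK) hc₀.le)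
      (Real.exp_pos _).le)
  -- run B: volume `(⟨P.d, P.L, P.m, P.K + n, P.hd, P.hL⟩ : Params)`
  have hεB : 0 < ((⟨P.d, P.L, P.m, P.K + n, P.hd, P.hL⟩ : Params)).eps := Params.eps_pos _
  have hMK' : ∀ μ, M μ = (⟨P.d, P.L, P.m, P.K + n, P.hd, P.hL⟩ : Params).sitesPerDir (P.K + n) := fun μ => by
    rw [hMK μ]; exact (sitesPerDir_finerVolume P n).symm
  have hN : P.L ^ n * P.L ^ P.K = P.L ^ (P.K + n) := by
    rw [pow_add, mul_comm]
  have hB := H ((⟨P.d, P.L, P.m, P.K + n, P.hd, P.hL⟩ : Params)) hPd hPL (show 1 ≤ P.K + n by omega) M hMK' (P.L ^ n * P.L ^ P.K) hN xt' x' hx'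
    bt b' hb' (t / ((⟨P.d, P.L, P.m, P.K + n, P.hd, P.hL⟩ : Params)).eps) (div_nonneg ht0 hεB.le)
    (fun z hz => by rw [div_le_iff₀ hεB, mul_comm]; exact hD' z hz)
  rw [mul_div_cancel₀ _ hεB.ne'] at hB
  have hdecB : |minimiser (P.L ^ n * P.L ^ P.K) M (aK a P.L (P.K + n)) (((P.L ^ n * P.L ^ P.K : ℕ) : ℝ) ^ 2) m2
        (Pi.single bt 1) xt'| ≤ a * c₀ * Real.exp (-(δ₀ * t)) :=
    hB.trans (mul_le_mul_of_nonneg_right (mul_le_mul_of_nonneg_right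
      (aK_le ha hLr (show 1 ≤ P.K + n by omega)) hc₀.le) (Real.exp_pos _).le)
  exact king_prop38_torus_of_decay hPd0 hPodd hPL2 hK hn M ha hm hγ0 hγ1 bt xt xt' hxx hdecA hdecB

end Torus

end Literature.MathematicalPhysics.QuantumFieldTheory.King1986
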